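import Summits.Schanuel.Schanuel.Theorems.ZilberEacExpExpRoot
import HarnessLib

/-!
# The exponential–exponential balance over graph bases of EVERY degree `D ≥ 3` (existence)

Zilber's Exponential-Algebraic Closedness, case ladder (host summit Schanuel, cell `pub-schanuel`,
seat 2, gen 8).  For EVERY `p ∈ ℂ[x]` of degree `D ≥ 3`, EVERY `A ∈ ℂ[x]` and every
`F ∈ ℂ[u] ∖ {0}` the equation `e^{z} = A(z) + e^{p(z)} F(e^{p(z)})` — exponential points of the
moving-target surface `{x₁ = p(x₀), y₀ = A(x₀) + y₁ F(y₁)}` — has solutions `z_k` for all large `k`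
with `Re p(z_k) ≥ ρ k^{1/D}` and `‖p(z_k)‖ ≤ C k` (`exists_solution_expExp_general`).  No sign
condition on `lc(p)`: the EXPLOSION regimes (`Re(lc(p)(±i)^D) > 0`, odd `D` with bad second-order
sign, …) left open by the lattice-centre theorems are covered.  (`D = 2`: `ZilberEacExpExpBalance`.)

Mechanism: balance `e^{z} ≈ lc(F) e^{e p(z)}` (`e = 1 + deg F`).  Near a root `z_k` of
`e p(z) - z = 2πik - log lc(F)` pointing to the right (`exists_root_balance`: `Re z_k ≥ r_k/4`,
`r_k ≍ k^{1/D}`) use the LINEAR local coordinate `z = z_k + λ_k t`, `λ_k = 1/(1 - e p'(z_k))`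
(`= O(r_k^{1-D})`): then `ζ := z - e p(z) + 2πik - log lc F = t - h_k(t)` with `h_k = O(1/r_k)`
(Taylor, `exists_linearisation_bound`), the equation reads `e^{t} = e^{h_k}(1 + g_k) =: 1 + G_k`
with `g_k = (A(z) + u F̃(u)) e^{ζ - z} → 0` (`expExp_perturbation_bound_of_norm_le`), everything is
ENTIRE in `t` (no branch of `p^{-1}` is needed), and the contraction lemma
`ExpDominant.exists_exp_eq_one_add` applies (`exists_solution_near_root`).

HONEST FRAMING: existence for these `n = 2` surfaces is Mantova–Masser's Theorem 1.1 in print; NEW is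
the explicit mechanism with `Re p(z) ≍ k^{1/D}`, feeding THEOREM G (density,
`ZilberEacExpExpDensityGeneral`); `EC(3,2)` OPEN; NOT Schanuel's conjecture; EAC ⇏ SC.
-/

noncomputable section

open Complex Filter Topology Metric
open Literature.NumberTheory.Transcendental Literature.ModelTheory.Zilber

set_option linter.dupNamespace false

namespace Summit.Schanuel.Schanuel.Theorems

/-- **Back-translation of the linearised equation.**  If `ζ = t - h`,
`lc(F) u^{e} = e^{z - ζ}` and `e^{t} = 1 + (e^{h}(1 + g) - 1)` with `g = (A(z) + u F̃(u)) e^{ζ - z}`,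
then `e^{z} = A(z) + u F(u)`. [folklore] -/
theorem exp_eq_of_linearised {A F : Polynomial ℂ} {z ζ t h u : ℂ} (hζ : ζ = t - h)
    (hcue : F.leadingCoeff * u ^ (F.natDegree + 1) = exp (z - ζ))
    (hfix : exp t = 1 + (exp h * (1 + (A.eval z + u * F.eraseLead.eval u) * exp (ζ - z)) - 1)) :
    exp z = A.eval z + u * F.eval u := by
  have hζexp : exp ζ = 1 + (A.eval z + u * F.eraseLead.eval u) * exp (ζ - z) := by
    have h1 : exp ζ = exp (-h) * exp t := by rw [← Complex.exp_add]; congr 1; rw [hζ]; ring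
    rw [h1, hfix, add_sub_cancel, ← mul_assoc, ← Complex.exp_add, neg_add_cancel, Complex.exp_zero,
      one_mul]
  have h2 : exp z = exp (z - ζ) * exp ζ := by rw [← Complex.exp_add]; congr 1; ring
  have h3 : exp z = exp (z - ζ) + (A.eval z + u * F.eraseLead.eval u) := by
    rw [h2, hζexp, mul_add, mul_one, ← mul_assoc, mul_comm (exp (z - ζ)) (A.eval z + _), mul_assoc,
      ← Complex.exp_add, show z - ζ + (ζ - z) = 0 by ring, Complex.exp_zero, mul_one]
  rw [mul_eval_eq_leadingCoeff_mul_pow_add F u, hcue, h3]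
  ring

/-- **One step of the balance (the contraction in the linear coordinate).**  Data: a root `z₀` of
`e p(z) - z = V` (`e = 1 + deg F`, `Λ + V ∈ 2πiℤ`, `e^{Λ} = lc F`), `λ = 1/(1 - e p'(z₀))` with
`‖λ‖ ≤ L`, the linearisation error `≤ 1/200` on `‖t‖ ≤ 1`, and the perturbation bound `≤ 1/200` for
`‖z - z₀‖ ≤ L`, `‖ζ‖ ≤ 2`.  Then `e^{z} = A(z) + e^{p(z)}F(e^{p(z)})` has a solution `z` with
`‖z - z₀‖ ≤ L` and `e p(z) = z + V - ζ`, `‖ζ‖ ≤ 2`. (new) [cite: MantovaMasser2023, §1 Further remarks] -/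
theorem exists_solution_near_root (p A : Polynomial ℂ) (F : Polynomial ℂ) {z₀ l V Λ : ℂ} {L : ℝ}
    {k : ℤ} (hexpΛ : exp Λ = F.leadingCoeff) (hΛV : Λ + V = 2 * Real.pi * I * k)
    (hroot : ((F.natDegree + 1 : ℕ) : ℂ) * p.eval z₀ - z₀ - V = 0)
    (hl : l * (1 - ((F.natDegree + 1 : ℕ) : ℂ) * p.derivative.eval z₀) = 1) (hl1 : ‖l‖ ≤ L)
    (hh : ∀ t : ℂ, ‖t‖ ≤ 1 → ‖((F.natDegree + 1 : ℕ) : ℂ) *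
      (p.eval (z₀ + l * t) - p.eval z₀ - p.derivative.eval z₀ * (l * t))‖ ≤ 1 / 200)
    (hg : ∀ z ζ u : ℂ, ‖z - z₀‖ ≤ L → ‖ζ‖ ≤ 2 →
      F.leadingCoeff * u ^ (F.natDegree + 1) = exp (z - ζ) →
      ‖(A.eval z + u * F.eraseLead.eval u) * exp (ζ - z)‖ ≤ 1 / 200) :
    ∃ z ζ : ℂ, exp z = A.eval z + exp (p.eval z) * F.eval (exp (p.eval z)) ∧ ‖z - z₀‖ ≤ L ∧
      ‖ζ‖ ≤ 2 ∧ ((F.natDegree + 1 : ℕ) : ℂ) * p.eval z = z + V - ζ := by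
  set e : ℕ := F.natDegree + 1 with he
  -- the functions of the local coordinate `t`
  set zf : ℂ → ℂ := fun t => z₀ + l * t with hzf
  set hf : ℂ → ℂ := fun t =>
    (e : ℂ) * (p.eval (z₀ + l * t) - p.eval z₀ - p.derivative.eval z₀ * (l * t)) with hhf
  set ζf : ℂ → ℂ := fun t => zf t - (e : ℂ) * p.eval (zf t) + V with hζf
  set uf : ℂ → ℂ := fun t => exp (p.eval (zf t)) with huf
  set gf : ℂ → ℂ := fun t => (A.eval (zf t) + uf t * F.eraseLead.eval (uf t)) * exp (ζf t - zf t)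
    with hgf
  set Gf : ℂ → ℂ := fun t => exp (hf t) * (1 + gf t) - 1 with hGf
  have hζ : ∀ t, ζf t = t - hf t := by
    intro t
    simp only [hζf, hzf, hhf]
    linear_combination (-1 : ℂ) * hroot + t * hl
  have hcue : ∀ t, F.leadingCoeff * uf t ^ e = exp (zf t - ζf t) := by
    intro t
    rw [← hexpΛ, huf, ← Complex.exp_nat_mul, ← Complex.exp_add]
    have : Λ + (e : ℂ) * p.eval (zf t) = zf t - ζf t + k * (2 * Real.pi * I) := by
      simp only [hζf]; linear_combination hΛV
    rw [this, Complex.exp_add, Complex.exp_int_mul_two_pi_mul_I, mul_one]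
  -- bounds on the unit disc
  have hbd : ∀ t, ‖t‖ ≤ 1 → ‖hf t‖ ≤ 1 / 200 ∧ ‖ζf t‖ ≤ 2 ∧ ‖zf t - z₀‖ ≤ L := by
    intro t ht
    have h1 : ‖hf t‖ ≤ 1 / 200 := hh t ht
    refine ⟨h1, ?_, ?_⟩
    · rw [hζ t]; exact (norm_sub_le _ _).trans (by linarith)
    · simp only [hzf, add_sub_cancel_left, norm_mul]
      nlinarith [norm_nonneg l, norm_nonneg t]
  have hGsmall : ∀ t, ‖t‖ ≤ 1 → ‖Gf t‖ ≤ 1 / 32 := by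
    intro t ht
    obtain ⟨h1, h2, h3⟩ := hbd t ht
    exact norm_exp_mul_one_add_sub_one_le h1 (hg _ _ _ h3 h2 (hcue t))
  -- holomorphy
  have hzf_d : Differentiable ℂ zf :=
    (differentiable_const _).add ((differentiable_const _).mul differentiable_id)
  have hpz_d : Differentiable ℂ (fun t => p.eval (zf t)) := p.differentiable.comp hzf_d
  have hhf_d : Differentiable ℂ hf := by
    simp only [hhf]
    exact (differentiable_const _).mul (((p.differentiable.comp hzf_d).sub
      (differentiable_const _)).sub ((differentiable_const _).mul
        ((differentiable_const _).mul differentiable_id)))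
  have hζf_d : Differentiable ℂ ζf :=
    (hzf_d.sub ((differentiable_const _).mul hpz_d)).add (differentiable_const _)
  have huf_d : Differentiable ℂ uf := hpz_d.cexp
  have hgf_d : Differentiable ℂ gf :=
    ((A.differentiable.comp hzf_d).add (huf_d.mul (F.eraseLead.differentiable.comp huf_d))).mul
      (hζf_d.sub hzf_d).cexp
  have hGf_d : Differentiable ℂ Gf :=
    (hhf_d.cexp.mul ((differentiable_const _).add hgf_d)).sub (differentiable_const _)
  -- the contraction lemma in one variable
  set G : Fin 1 → (Fin 1 → ℂ) → ℂ := fun _ ξ => Gf (ξ 0) with hG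
  have hGdiff : ∀ j, DifferentiableOn ℂ (G j) (ball 0 1) := fun _ =>
    (hGf_d.comp (differentiable_apply (0 : Fin 1))).differentiableOn
  have hGbound : ∀ j, ∀ ξ ∈ ball (0 : Fin 1 → ℂ) 1, ‖G j ξ‖ ≤ 1 / 32 := by
    intro j ξ hξ
    rw [mem_ball, dist_zero_right] at hξ
    exact hGsmall (ξ 0) ((norm_le_pi_norm ξ 0).trans hξ.le)
  obtain ⟨ξ, hξ, hfix⟩ := ExpDominant.exists_exp_eq_one_add G (ε := 1 / 32) (by norm_num)
    (by norm_num) hGdiff hGbound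
  set t : ℂ := ξ 0 with htdef
  have ht1 : ‖t‖ ≤ 1 := ((norm_le_pi_norm ξ 0).trans hξ).trans (by norm_num)
  obtain ⟨-, hζ2, hz1⟩ := hbd t ht1
  refine ⟨zf t, ζf t, ?_, hz1, hζ2, ?_⟩
  · have hmain : exp t = 1 + (exp (hf t) * (1 + (A.eval (zf t) + uf t * F.eraseLead.eval (uf t)) *
        exp (ζf t - zf t)) - 1) := hfix 0
    exact exp_eq_of_linearised (hζ t) (hcue t) hmain
  · simp only [hζf]; ring

/-- **Exponential–exponential balance over a graph base of any degree `D ≥ 3`.**  For `p ∈ ℂ[x]`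
with `deg p = D ≥ 3`, any `A ∈ ℂ[x]` and `F ≠ 0` there are `ρ > 0` and `C` such that for all large
`k` the equation `e^{z} = A(z) + e^{p(z)} F(e^{p(z)})` has a solution with `ρ k^{1/D} ≤ Re p(z)` and
`‖p(z)‖ ≤ C k`. (new) [cite: MantovaMasser2023, §1 Further remarks] -/
theorem exists_solution_expExp_general (p : Polynomial ℂ) (hD : 3 ≤ p.natDegree) (A : Polynomial ℂ)
    {F : Polynomial ℂ} (hF : F ≠ 0) :
    ∃ ρ C : ℝ, 0 < ρ ∧ ∀ᶠ k : ℕ in atTop, ∃ z : ℂ,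
      exp z = A.eval z + exp (p.eval z) * F.eval (exp (p.eval z)) ∧
      ρ * (k : ℝ) ^ ((p.natDegree : ℝ)⁻¹) ≤ (p.eval z).re ∧ ‖p.eval z‖ ≤ C * k := by
  classical
  -- ### names and constants
  set e : ℕ := F.natDegree + 1 with he
  have hepos : 0 < e := by positivity
  obtain ⟨R₀, hR₀⟩ := exists_root_balance p hD hepos
  obtain ⟨R₁, hR₁1, hR₁⟩ := exists_derivative_lower_bound p hD hepos
  obtain ⟨K, hK0, hK⟩ := exists_linearisation_bound p hD hepos
  set D : ℕ := p.natDegree with hDdef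
  set α : ℂ := p.leadingCoeff with hα
  have hp0 : p ≠ 0 := by rintro rfl; simp [hDdef] at hD
  have hα0 : α ≠ 0 := Polynomial.leadingCoeff_ne_zero.2 hp0
  have hαpos : 0 < ‖α‖ := norm_pos_iff.2 hα0
  have hD0 : D ≠ 0 := by omega
  have hDpos : (0 : ℝ) < D := by exact_mod_cast (show 0 < D by omega)
  have he0 : (e : ℂ) ≠ 0 := by exact_mod_cast hepos.ne'
  have he1 : (1 : ℝ) ≤ e := by exact_mod_cast hepos
  have hepos' : (0 : ℝ) < e := by exact_mod_cast hepos
  set c : ℂ := F.leadingCoeff with hcdef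
  have hc0 : c ≠ 0 := Polynomial.leadingCoeff_ne_zero.2 hF
  have hcpos : 0 < ‖c‖ := norm_pos_iff.2 hc0
  set Λ : ℂ := log c with hΛ
  have hexpΛ : exp Λ = c := Complex.exp_log hc0
  set BA : ℝ := ∑ i ∈ Finset.range (A.natDegree + 1), ‖A.coeff i‖ with hBA
  have hBA0 : 0 ≤ BA := Finset.sum_nonneg fun _ _ => norm_nonneg _
  set Be : ℝ := ∑ i ∈ Finset.range (F.eraseLead.natDegree + 1), ‖F.eraseLead.coeff i‖ with hBe
  have hBe0 : 0 ≤ Be := Finset.sum_nonneg fun _ _ => norm_nonneg _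
  set T : ℝ := 600 * (Be + 1) * Real.exp 4 / ‖c‖ + 1 with hT
  have hTpos : 0 < T := by positivity
  set c₀ : ℝ := e * D * ‖α‖ / 4 with hc₀
  -- the values `V k = 2πik - Λ`, principal roots `w k`, radii `r k`
  set V : ℕ → ℂ := fun k => 2 * Real.pi * I * k - Λ with hV
  set w : ℕ → ℂ := fun k => (V k / (e * α)) ^ ((D : ℂ)⁻¹) with hw
  set r : ℕ → ℝ := fun k => ‖w k‖ with hr
  have hΛV : ∀ k : ℕ, Λ + V k = 2 * Real.pi * I * k := fun k => by simp only [hV]; ring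
  have hVre : ∀ k : ℕ, (V k).re = -Λ.re := fun k => by
    simp [hV, Complex.mul_re, Complex.mul_im]
  have hVnorm : ∀ k : ℕ, ‖V k‖ ≤ 2 * Real.pi * k + ‖Λ‖ := fun k => by
    simp only [hV]
    refine (norm_sub_le _ _).trans ?_
    rw [show (2 * Real.pi * I * k : ℂ) = ((2 * Real.pi * k : ℝ) : ℂ) * I by push_cast; ring,
      norm_mul, Complex.norm_I, mul_one, Complex.norm_real, Real.norm_eq_abs,
      abs_of_nonneg (by positivity)]
  have hVnorm' : ∀ k : ℕ, 2 * Real.pi * k - ‖Λ‖ ≤ ‖V k‖ := fun k => by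
    simp only [hV]
    have h := norm_sub_norm_le (2 * Real.pi * I * k : ℂ) Λ
    rw [show (2 * Real.pi * I * k : ℂ) = ((2 * Real.pi * k : ℝ) : ℂ) * I by push_cast; ring,
      norm_mul, Complex.norm_I, mul_one, Complex.norm_real, Real.norm_eq_abs,
      abs_of_nonneg (by positivity)] at h
    rw [show (2 * Real.pi * I * k : ℂ) = ((2 * Real.pi * k : ℝ) : ℂ) * I by push_cast; ring]
    exact h
  have hr0 : ∀ k, 0 ≤ r k := fun k => norm_nonneg _
  have hrD : ∀ k, r k ^ D = ‖V k‖ / (e * ‖α‖) := fun k => by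
    simp only [hr, hw]
    rw [← norm_pow, Complex.cpow_nat_inv_pow _ hD0, norm_div, norm_mul, Complex.norm_natCast]
  have hr_rpow : ∀ k, r k = (‖V k‖ / (e * ‖α‖)) ^ ((D : ℝ)⁻¹) := fun k => by
    rw [← hrD, Real.pow_rpow_inv_natCast (hr0 k) hD0]
  -- `r k ≥ ρ₁ k^{1/D}` once `π k ≥ ‖Λ‖`
  set ρ₁ : ℝ := (Real.pi / (e * ‖α‖)) ^ ((D : ℝ)⁻¹) with hρ₁
  have hρ₁pos : 0 < ρ₁ := Real.rpow_pos_of_pos (by positivity) _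
  have hr_lower : ∀ k : ℕ, ‖Λ‖ ≤ Real.pi * k → ρ₁ * (k : ℝ) ^ ((D : ℝ)⁻¹) ≤ r k := by
    intro k hk
    rw [hr_rpow, hρ₁, ← Real.mul_rpow (by positivity) (by positivity)]
    refine Real.rpow_le_rpow (by positivity) ?_ (by positivity)
    rw [div_mul_eq_mul_div, div_le_div_iff_of_pos_right (by positivity)]
    linarith [hVnorm' k]
  have hk_rpow : Tendsto (fun k : ℕ => ρ₁ * (k : ℝ) ^ ((D : ℝ)⁻¹)) atTop atTop :=
    ((tendsto_rpow_atTop (by positivity)).comp tendsto_natCast_atTop_atTop).const_mul_atTop hρ₁pos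
  have hΛk : ∀ᶠ k : ℕ in atTop, ‖Λ‖ ≤ Real.pi * k :=
    (tendsto_natCast_atTop_atTop.const_mul_atTop Real.pi_pos).eventually_ge_atTop ‖Λ‖
  have hr_tendsto : Tendsto r atTop atTop := by
    refine tendsto_atTop_mono' atTop ?_ hk_rpow
    filter_upwards [hΛk] with k hk using hr_lower k hk
  -- ### the eventual conditions
  have hs_tendsto : Tendsto (fun k => r k / 4) atTop atTop := hr_tendsto.atTop_div_const (by norm_num)
  have E3 : ∀ᶠ k : ℕ in atTop, BA * 12 ^ A.natDegree * Real.exp 3 *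
      ((r k / 4) ^ A.natDegree * Real.exp (-(r k / 4))) ≤ 1 / 600 := by
    have h := ((Real.tendsto_pow_mul_exp_neg_atTop_nhds_zero A.natDegree).comp hs_tendsto).const_mul
      (BA * 12 ^ A.natDegree * Real.exp 3)
    rw [mul_zero] at h
    exact h.eventually (eventually_le_nhds (by norm_num))
  have E4 : ∀ᶠ k : ℕ in atTop, (Be + 1) * (1 / T + T ^ F.natDegree) * Real.exp 3 *
      ((r k / 4) ^ 0 * Real.exp (-(r k / 4))) ≤ 1 / 600 := by
    have h := ((Real.tendsto_pow_mul_exp_neg_atTop_nhds_zero 0).comp hs_tendsto).const_mul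
      ((Be + 1) * (1 / T + T ^ F.natDegree) * Real.exp 3)
    rw [mul_zero] at h
    exact h.eventually (eventually_le_nhds (by norm_num))
  have E1 : ∀ᶠ k : ℕ in atTop, max R₀ (max (4 / 3 * R₁) (800 * K / 3 + 1)) ≤ r k :=
    hr_tendsto.eventually_ge_atTop _
  have E7 : ∀ᶠ k : ℕ in atTop, 8 * (3 + ‖Λ‖) ≤ ρ₁ * (k : ℝ) ^ ((D : ℝ)⁻¹) :=
    hk_rpow.eventually_ge_atTop _
  -- ### conclusion
  refine ⟨ρ₁ / (8 * e), (5 / (4 * (e * ‖α‖)) + 1) * (2 * Real.pi + ‖Λ‖) + 3, by positivity, ?_⟩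
  filter_upwards [hΛk, E1, E3, E4, E7, eventually_ge_atTop 1] with k hΛk' h1 h3 h4 h7 hk1
  have hR₀r : R₀ ≤ r k := le_of_max_le_left h1
  have hR₁r : 4 / 3 * R₁ ≤ r k := le_of_max_le_left (le_of_max_le_right h1)
  have hKr : 800 * K / 3 + 1 ≤ r k := le_of_max_le_right (le_of_max_le_right h1)
  have hr1 : 1 ≤ r k := by linarith
  have hk1' : (1 : ℝ) ≤ k := by exact_mod_cast hk1
  -- the root and the local coordinate
  obtain ⟨z₀, hroot, hre0, hzup, hzlo⟩ := hR₀ (V k) hR₀r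
  have hz1 : R₁ ≤ ‖z₀‖ := by linarith
  have hz1' : 1 ≤ ‖z₀‖ := hR₁1.trans hz1
  obtain ⟨hXle, hX1⟩ := hR₁ z₀ hz1
  have hne : (1 - (e : ℂ) * p.derivative.eval z₀) ≠ 0 := by
    intro h; rw [h, norm_zero] at hXle; linarith
  set l : ℂ := (1 - (e : ℂ) * p.derivative.eval z₀)⁻¹ with hl
  have hl_eq : l * (1 - (e : ℂ) * p.derivative.eval z₀) = 1 := inv_mul_cancel₀ hne
  have hl_norm : ‖l‖ * ‖1 - (e : ℂ) * p.derivative.eval z₀‖ = 1 := by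
    rw [← norm_mul, hl_eq, norm_one]
  have hlX : ‖l‖ * (c₀ * ‖z₀‖ ^ (D - 1)) ≤ 1 := by
    rw [← hl_norm]; exact mul_le_mul_of_nonneg_left hXle (norm_nonneg _)
  have hl1 : ‖l‖ ≤ 1 :=
    calc ‖l‖ = ‖l‖ * 1 := (mul_one _).symm
      _ ≤ ‖l‖ * (c₀ * ‖z₀‖ ^ (D - 1)) := mul_le_mul_of_nonneg_left hX1 (norm_nonneg _)
      _ ≤ 1 := hlX
  -- the linearisation error
  have hh : ∀ t : ℂ, ‖t‖ ≤ 1 → ‖(e : ℂ) *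
      (p.eval (z₀ + l * t) - p.eval z₀ - p.derivative.eval z₀ * (l * t))‖ ≤ 1 / 200 := by
    intro t ht
    refine (hK z₀ l t hz1' ht hlX hX1).trans ?_
    rw [div_le_iff₀ (by linarith)]
    linarith only [hzlo, hKr, hK0]
  -- the perturbation bound
  have hg : ∀ z ζ u : ℂ, ‖z - z₀‖ ≤ 1 → ‖ζ‖ ≤ 2 →
      F.leadingCoeff * u ^ (F.natDegree + 1) = exp (z - ζ) →
      ‖(A.eval z + u * F.eraseLead.eval u) * exp (ζ - z)‖ ≤ 1 / 200 := by
    intro z ζ u hz hζ hcue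
    have hb := expExp_perturbation_bound_of_norm_le A hF hTpos z ζ u hζ hcue
    rw [← hcdef, ← hBA, ← hBe] at hb
    refine hb.trans ?_
    -- geometry of `z`
    have hzre : r k / 4 - 1 ≤ z.re := by
      have h := Complex.abs_re_le_norm (z - z₀)
      rw [Complex.sub_re, abs_le] at h
      linarith [h.1]
    have hznorm : ‖z‖ ≤ 3 * r k := by
      have : ‖z‖ ≤ ‖z₀‖ + ‖z - z₀‖ := by
        calc ‖z‖ = ‖z₀ + (z - z₀)‖ := by ring_nf
          _ ≤ ‖z₀‖ + ‖z - z₀‖ := norm_add_le _ _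
      linarith
    have hmax : max 1 ‖z‖ ≤ 12 * (r k / 4) := max_le (by linarith) (by linarith)
    have hmax0 : 0 ≤ max 1 ‖z‖ := zero_le_one.trans (le_max_left _ _)
    have hexpz : Real.exp (2 - z.re) ≤ Real.exp 3 * Real.exp (-(r k / 4)) := by
      rw [← Real.exp_add]; exact Real.exp_le_exp.2 (by linarith)
    have hterm1 : BA * max 1 ‖z‖ ^ A.natDegree * Real.exp (2 - z.re) ≤ 1 / 600 := by
      refine le_trans ?_ h3
      calc BA * max 1 ‖z‖ ^ A.natDegree * Real.exp (2 - z.re)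
          ≤ BA * (12 * (r k / 4)) ^ A.natDegree * (Real.exp 3 * Real.exp (-(r k / 4))) :=
            mul_le_mul (mul_le_mul_of_nonneg_left (pow_le_pow_left₀ hmax0 hmax _) hBA0) hexpz
              (by positivity) (by positivity)
        _ = BA * 12 ^ A.natDegree * Real.exp 3 * ((r k / 4) ^ A.natDegree * Real.exp (-(r k / 4))) := by
            rw [mul_pow]; ring
    have hterm2 : (Be + 1) * (1 / T + T ^ F.natDegree) * Real.exp (2 - z.re) ≤ 1 / 600 := by
      refine le_trans ?_ h4
      rw [pow_zero, one_mul, show (Be + 1) * (1 / T + T ^ F.natDegree) * Real.exp 3 *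
        Real.exp (-(r k / 4)) = (Be + 1) * (1 / T + T ^ F.natDegree) * (Real.exp 3 *
        Real.exp (-(r k / 4))) by ring]
      exact mul_le_mul_of_nonneg_left hexpz (by positivity)
    have hterm3 : (Be + 1) * Real.exp (2 * 2) / (‖c‖ * T) ≤ 1 / 600 := by
      rw [div_le_iff₀ (by positivity), hT, show (2 : ℝ) * 2 = 4 by norm_num]
      have : ‖c‖ * (600 * (Be + 1) * Real.exp 4 / ‖c‖ + 1) = 600 * (Be + 1) * Real.exp 4 + ‖c‖ := by
        field_simp
      rw [this]
      linarith [hcpos.le]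
    have hsum : (BA * max 1 ‖z‖ ^ A.natDegree + (Be + 1) * (1 / T + T ^ F.natDegree)) *
          Real.exp (2 - z.re) + (Be + 1) * Real.exp (2 * 2) / (‖c‖ * T) =
        BA * max 1 ‖z‖ ^ A.natDegree * Real.exp (2 - z.re) +
          (Be + 1) * (1 / T + T ^ F.natDegree) * Real.exp (2 - z.re) +
          (Be + 1) * Real.exp (2 * 2) / (‖c‖ * T) := by ring
    rw [hsum]
    linarith only [hterm1, hterm2, hterm3]
  -- the solution
  have hΛV' : Λ + V k = 2 * Real.pi * I * ((k : ℤ) : ℂ) := by rw [Int.cast_natCast]; exact hΛV k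
  obtain ⟨z, ζ, heq, hzz₀, hζ2, hpz⟩ :=
    exists_solution_near_root p A F hexpΛ hΛV' hroot hl_eq hl1 hh hg
  refine ⟨z, heq, ?_, ?_⟩
  · -- `Re p(z) = (Re z - Re Λ - Re ζ)/e ≥ ρ k^{1/D}`
    have hre : (e : ℝ) * (p.eval z).re = z.re - Λ.re - ζ.re := by
      have h := congrArg Complex.re hpz
      rw [show ((e : ℂ) * p.eval z).re = (e : ℝ) * (p.eval z).re by
        rw [show (e : ℂ) = ((e : ℝ) : ℂ) by push_cast; rfl, Complex.re_ofReal_mul]] at h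
      rw [h, Complex.sub_re, Complex.add_re, hVre]
      ring
    have hzre : r k / 4 - 1 ≤ z.re := by
      have h := Complex.abs_re_le_norm (z - z₀)
      rw [Complex.sub_re, abs_le] at h
      linarith [h.1]
    have hζre : ζ.re ≤ 2 := (Complex.re_le_norm ζ).trans hζ2
    have hΛre : Λ.re ≤ ‖Λ‖ := Complex.re_le_norm Λ
    have hlow := hr_lower k hΛk'
    rw [div_mul_eq_mul_div, div_le_iff₀ (by positivity)]
    linarith only [hre, hzre, hζre, hΛre, hlow, h7]
  · -- `‖p(z)‖ ≤ ‖z‖ + ‖V k‖ + 2 ≤ C k`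
    have h1 : ‖p.eval z‖ ≤ ‖z‖ + ‖V k‖ + ‖ζ‖ := by
      have h2 : ‖(e : ℂ) * p.eval z‖ = e * ‖p.eval z‖ := by rw [norm_mul, Complex.norm_natCast]
      have h3 : ‖p.eval z‖ ≤ e * ‖p.eval z‖ := le_mul_of_one_le_left (norm_nonneg _) he1
      have h4 : ‖z + V k - ζ‖ ≤ ‖z‖ + ‖V k‖ + ‖ζ‖ :=
        (norm_sub_le _ _).trans (by linarith only [norm_add_le z (V k)])
      rw [← h2, hpz] at h3
      linarith only [h3, h4]
    have hzn : ‖z‖ ≤ 5 / 4 * r k + 1 := by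
      have : ‖z‖ ≤ ‖z₀‖ + ‖z - z₀‖ := by
        calc ‖z‖ = ‖z₀ + (z - z₀)‖ := by ring_nf
          _ ≤ ‖z₀‖ + ‖z - z₀‖ := norm_add_le _ _
      linarith only [this, hzup, hzz₀]
    have hrle : r k ≤ ‖V k‖ / (e * ‖α‖) := by
      rw [← hrD]; exact le_self_pow₀ hr1 hD0
    have hea : 0 < e * ‖α‖ := by positivity
    have hΛk1 : ‖Λ‖ ≤ ‖Λ‖ * k := le_mul_of_one_le_right (norm_nonneg _) hk1'
    have hVk : ‖V k‖ ≤ (2 * Real.pi + ‖Λ‖) * k := (hVnorm k).trans (by linarith only [hΛk1])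
    set M : ℝ := (2 * Real.pi + ‖Λ‖) * k / (e * ‖α‖) with hM
    have hrM : r k ≤ M := hrle.trans (div_le_div_of_nonneg_right hVk hea.le)
    have hgoal : ((5 / (4 * (e * ‖α‖)) + 1) * (2 * Real.pi + ‖Λ‖) + 3) * k =
        5 / 4 * M + (2 * Real.pi + ‖Λ‖) * k + 3 * k := by
      rw [hM]; field_simp
    rw [hgoal]
    linarith only [h1, hζ2, hzn, hrM, hVk, hk1']

end Summit.Schanuel.Schanuel.Theorems

end
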